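import Summits.QuantumFields.YangMills.Theorems.BalabanLadderNTKernelVarianceFloor
import HarnessLib

/-!
# Crux `NT` (stmt-QuantumFields-19353): the volume-uniform TWO-POINT FLOOR `c/β² ≤ Var_{T,β}(φ_q)` — the plaquette's
# fluctuations are pinned at the Gaussian scale, for every compact gauge group (hypothesis-free)

Fleet lead prover of crux `NT` (unit `ym-spine-19353-p1`, g30).  Sequel of `Theorems/BalabanLadderNTKernelVarianceFloor`
(kernel variance floor on good exteriors; good exteriors are typical; a kernel floor integrates to a torus floor).  For any
lattice representation `r` of a compact `G` with `0 < dimE r.ρ` (automatic for compact SIMPLE `G`), on every odd torus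
`2L+1 ≥ 5`, for every plaquette `q` and every `β ≥ β₀`:

* **`exists_torusVar_plaquetteCost_ge`: `c/β² ≤ Var_{T,β}(φ_q) = ∫ (φ_q − ⟨φ_q⟩)² dμ_{T,β}`** (`φ_q = N − Re tr r(U_q)`), with
  `c, β₀ > 0` depending on `(G, r)` only — torus DLR at the first link of `q`, the kernel floor on the good exteriors, Markov
  twice on g28's sharp one-point ceiling for the rarity of the bad ones;
* **`torusVar_plaquetteCost_pin` (`…_of_simple`): the TWO-SIDED VARIANCE PIN `c/β² ≤ ⟨φ_q²⟩ − ⟨φ_q⟩² ≤ C/β²`** (ceiling: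
  g28's sharp second moment `⟨φ_q²⟩ ≤ K/β²`, `SharpCeilings.exists_plaquetteCost_moments_le_sharp`) — the connected
  plaquette–plaquette function at coincident points is EXACTLY of order `β⁻²`, uniformly in the volume: the floor twin of g28's
  `|Cov_{T,β}(A_x, A_y)| ≤ W/β²` (`SharpCeilings.exists_abs_torusCov_dens_le_sharp`).

HONEST FRAMING.  A two-point FLOOR at LATTICE scale (coincident plaquettes), i.e. tree-level lattice perturbation theory
(`Var φ ≍ D/(2β²)`) made rigorous and volume-uniform by a soft argument (small balls, two masses, DLR, Markov); it says nothing
about NT's β-uniform floor at the physical scale `a(β)⁻¹` (dimensional transmutation), nothing about decay, the seam or the gap.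
NT is NOT proved; the Yang–Mills mass gap is NOT proved; not Clay.
Refs: Seiler LNP 159 Ch. 2 (DLR); Montvay–Münster 1994 §3.2; Chatterjee arXiv:1602.01222.
-/

set_option autoImplicit false

noncomputable section

open scoped Matrix Matrix.Norms.Frobenius ENNReal NNReal Topology BigOperators
open MeasureTheory Measure Filter Set ProbabilityTheory
open Literature.MathematicalPhysics.QuantumLattice
open Literature.MathematicalPhysics.QuantumFieldTheory hiding ZdEdge
open Literature.Probability.LatticeModels (glueWith glueWith_apply_mem glueWith_apply_not_mem)
open Summit.QuantumFields.YangMills.Theorems.FreeEnergyLogCoefficient (dimE)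
open Summit.QuantumFields.YangMills.Theorems.OSLegsFromFemtoAndGap.StubLower (integral_torusLift_eq_integral_kernel
  exists_near_of_mem_plaquetteEdges_touching)
open Literature.MathematicalPhysics.QuantumFieldTheory.WilsonRP (plaqRe abs_plaqRe_le measurable_plaqRe)

namespace Summit.QuantumFields.YangMills.Cruxes.NT.LinkEquipartition

/-! ## The variance identity -/

section VarianceIdentity

/-- The variance identity `∫ (φ − ∫φ)² = ∫ φ² − (∫ φ)²` for a bounded measurable real observable on a probability space.
[folklore] -/
theorem integral_sq_sub_integral_eq {Ω : Type*} [MeasurableSpace Ω] (μ : Measure Ω) [IsProbabilityMeasure μ]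
    {φ : Ω → ℝ} (hφ : Measurable φ) {B : ℝ} (hB : ∀ x, |φ x| ≤ B) :
    ∫ x, (φ x - ∫ y, φ y ∂μ) ^ 2 ∂μ = ∫ x, φ x ^ 2 ∂μ - (∫ y, φ y ∂μ) ^ 2 := by
  set m := ∫ y, φ y ∂μ with hm
  have hint : Integrable φ μ := Integrable.of_mem_Icc (-B) B hφ.aemeasurable (ae_of_all _ fun x => abs_le.1 (hB x))
  have hint2 : Integrable (fun x => φ x ^ 2) μ := by
    refine Integrable.of_mem_Icc 0 (B ^ 2) (hφ.pow_const 2).aemeasurable (ae_of_all _ fun x => ⟨sq_nonneg _, ?_⟩)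
    calc φ x ^ 2 = |φ x| ^ 2 := (sq_abs _).symm
      _ ≤ B ^ 2 := pow_le_pow_left₀ (abs_nonneg _) (hB x) 2
  have e : (fun x => (φ x - m) ^ 2) = fun x => (φ x ^ 2 - 2 * m * φ x) + m ^ 2 := by
    funext x; ring
  have h3 : Integrable (fun x => φ x ^ 2 - 2 * m * φ x) μ := hint2.sub (hint.const_mul (2 * m))
  rw [e, integral_add h3 (integrable_const _), integral_sub hint2 (hint.const_mul (2 * m)),
    integral_const_mul, integral_const, smul_eq_mul, probReal_univ]
  ring

end VarianceIdentity

/-! ## The torus: `c/β² ≤ Var_{T,β}(φ_q)` on every odd torus, and the two-sided variance pin -/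

section Torus

variable (G : Type) [Group G] [TopologicalSpace G] [IsTopologicalGroup G] [CompactSpace G]
  [MeasurableSpace G] [BorelSpace G] (r : LatticeRep G)

set_option maxHeartbeats 400000 in
/-- **THE TWO-POINT FLOOR, uniformly in the volume**: there are `c, β₀ > 0` (depending on `(G, r)` only) with
`c/β² ≤ Var_{T,β}(φ_q) = ∫ (φ_q − ⟨φ_q⟩)² dμ_{T,β}` for every `β ≥ β₀`, every odd torus `2L+1 ≥ 5` and every plaquette
`q = (x̄, orientation)` (`φ_q = N − Re tr r(U_q)`) — the plaquette's fluctuations are NOT frozen faster than the Gaussian scale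
`1/β`, whatever the volume. [folklore] -/
theorem exists_torusVar_plaquetteCost_ge (hD : 0 < dimE r.ρ) :
    ∃ c β₀ : ℝ, 0 < c ∧ 0 < β₀ ∧ ∀ β : ℝ, β₀ ≤ β → ∀ (L : ℕ), 2 ≤ L →
      ∀ (x : Fin 4 → ℤ) (q : {q : Fin 4 × Fin 4 // q.1 < q.2}),
      c / β ^ 2 ≤ ∫ U, (plaquetteCost r.ρ U (Literature.Probability.LatticeModels.Torus.proj (2 * L + 1) x, q) -
          ∫ V, plaquetteCost r.ρ V (Literature.Probability.LatticeModels.Torus.proj (2 * L + 1) x, q)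
            ∂(wilsonMeasure (d := 4) (L := 2 * L + 1) r.ρ β)) ^ 2 ∂(wilsonMeasure (d := 4) (L := 2 * L + 1) r.ρ β) := by
  classical
  haveI := r.secondCountableTopology
  obtain ⟨θ, hθ0, hgood⟩ := exists_good_exteriors G r
  obtain ⟨κ, β₁, hκ, hβ₁, hker⟩ :=
    kernel_variance_floor_plaquette r.ρ r.continuous r.injective r.mem_unitary hD hθ0.le 6 (by norm_num)
  refine ⟨κ / 2, max β₁ 4, by positivity, lt_of_lt_of_le hβ₁ (le_max_left _ _), fun β hβ L hL x q => ?_⟩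
  have hββ₁ : β₁ ≤ β := (le_max_left _ _).trans hβ
  have hβ4 : 4 ≤ β := (le_max_right _ _).trans hβ
  haveI : NeZero (2 * L + 1) := ⟨by omega⟩
  set μT := wilsonMeasure (d := 4) (L := 2 * L + 1) (G := G) r.ρ β with hμT
  haveI : IsProbabilityMeasure μT := isProbabilityMeasure_wilsonMeasure (d := 4) (L := 2 * L + 1) r.ρ r.continuous β
  -- the plaquette of `ℤ⁴`, its first link, the `ℤ⁴` observable
  set p : ZdPlaquette 4 := (x, q) with hp
  set e : ZdEdge 4 := (x, q.1.1) with he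
  have hep : e ∈ plaquetteEdges p := by simp [plaquetteEdges, he, hp]
  have hpe : p ∈ plaquettesTouching {e} := mem_plaquettesTouching_singleton.2 hep
  set qT : Plaquette 4 (2 * L + 1) := (Literature.Probability.LatticeModels.Torus.proj (2 * L + 1) x, q) with hqT
  set F : LGConfig 4 G → ℝ := fun U => (r.N : ℝ) - plaquetteObs r.ρ x q.1.1 q.1.2 U with hF
  have hFlift : ∀ U : GaugeConfig 4 (2 * L + 1) G, plaquetteCost r.ρ U qT = F (torusLift (2 * L + 1) U) := by
    intro U
    simp only [hF, plaquetteCost, hqT, plaquetteObs, ← plaquetteHolonomy_torusProj]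
  have hFcont : Continuous F := continuous_const.sub (continuous_plaquetteObs r.ρ r.continuous _ _ _)
  have hFbd : ∀ U, |F U| ≤ 2 * r.N := by
    intro U
    have h := abs_le.1 (abs_plaquetteObs_le_holds r.ρ r.mem_unitary x q.1.1 q.1.2 U)
    rw [hF, abs_le]; constructor <;> linarith [h.1, h.2]
  have hFcyl : IsCylinder F (plaquetteEdges p) := by
    intro U V h
    simp only [hF]
    rw [isCylinder_plaquetteObs r.ρ p h]
  -- the torus mean
  set m : ℝ := ∫ V, plaquetteCost r.ρ V qT ∂μT with hm
  have hmabs : |m| ≤ 2 * r.N := by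
    have h := norm_integral_le_of_norm_le_const (μ := μT) (f := fun V => plaquetteCost r.ρ V qT) (C := 2 * r.N)
      (ae_of_all _ fun V => by rw [Real.norm_eq_abs, hFlift V]; exact hFbd _)
    simpa [Real.norm_eq_abs, hm] using h
  -- the window of the plaquette's edges
  have hwin : ∀ e' ∈ ({e} : Finset (ZdEdge 4)) ∪ plaquetteEdges p, ∀ j,
      (x j - 2) + 1 ≤ e'.1 j ∧ e'.1 j + 2 ≤ (x j - 2) + ((2 * L + 1 : ℕ) : ℤ) := by
    intro e' he' j
    refine window_of_touching hL x q.1.1 e' ?_ j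
    rcases Finset.mem_union.1 he' with h1 | h2
    · exact Finset.mem_union_left _ h1
    · exact Finset.mem_union_right _ (Finset.mem_biUnion.2 ⟨p, hpe, h2⟩)
  -- the kernel floor on the good exteriors
  have hcard : (plaquettesTouching {e}).card ≤ 6 := (card_plaquettesTouching_singleton_le e).trans (by norm_num)
  have hfloor : ∀ U ∈ {U : GaugeConfig 4 (2 * L + 1) G |
      wilsonBoundaryAction r.ρ {e} (torusLift (2 * L + 1) U) ≤ θ / β ∧
        ∫ V, wilsonBoundaryAction r.ρ {e} V ∂(ymSpecification r.ρ β {e} (torusLift (2 * L + 1) U)) ≤ θ / β},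
      κ / β ^ 2 ≤ ∫ V, (F V - m) ^ 2 ∂(ymSpecification r.ρ β {e} (torusLift (2 * L + 1) U)) :=
    fun U hU => hker β hββ₁ p e (torusLift (2 * L + 1) U) hep hcard hU.1 hU.2 m
  have hGm : MeasurableSet {U : GaugeConfig 4 (2 * L + 1) G |
      wilsonBoundaryAction r.ρ {e} (torusLift (2 * L + 1) U) ≤ θ / β ∧
        ∫ V, wilsonBoundaryAction r.ρ {e} V ∂(ymSpecification r.ρ β {e} (torusLift (2 * L + 1) U)) ≤ θ / β} :=
    ((isClosed_le ((continuous_wilsonBoundaryAction r.ρ r.continuous {e}).comp (continuous_torusLift _))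
        continuous_const).inter
      (isClosed_le ((continuous_integral_ymSpecification r.ρ r.continuous β {e}
        (continuous_wilsonBoundaryAction r.ρ r.continuous {e})
        (abs_wilsonBoundaryAction_singleton_le r.ρ r.mem_unitary e)).comp (continuous_torusLift _))
        continuous_const)).measurableSet
  have hmain := torus_integral_ge_of_good G r e hFcont hFbd hFcyl (fun j => x j - 2) hwin m hmabs hκ.le hGm
    (hgood L hL β hβ4 x q.1.1) hfloor
  have hgoal : ∫ U, (plaquetteCost r.ρ U qT - m) ^ 2 ∂μT = ∫ U, (F (torusLift (2 * L + 1) U) - m) ^ 2 ∂μT := by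
    refine integral_congr_ae (ae_of_all _ fun U => ?_)
    simp only [hFlift]
  rw [hgoal]
  exact hmain

/-- **THE TWO-SIDED VARIANCE PIN, uniformly in the volume**: there are `0 < c ≤ C` and `β₀ > 0` (depending on `(G, r)` only)
with `c/β² ≤ ⟨φ_q²⟩_{T,β} − ⟨φ_q⟩²_{T,β} ≤ C/β²` for every `β ≥ β₀`, every odd torus `2L+1 ≥ 5` and every plaquette — the
connected plaquette–plaquette function at coincident points is EXACTLY of order `β⁻²` (floor: this file; ceiling: g28's sharp
second moment `⟨φ_q²⟩ ≤ K/β²`). [folklore] -/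
theorem torusVar_plaquetteCost_pin (hD : 0 < dimE r.ρ) :
    ∃ c C β₀ : ℝ, 0 < c ∧ c ≤ C ∧ 0 < β₀ ∧ ∀ β : ℝ, β₀ ≤ β → ∀ (L : ℕ), 2 ≤ L →
      ∀ (x : Fin 4 → ℤ) (q : {q : Fin 4 × Fin 4 // q.1 < q.2}),
      c / β ^ 2 ≤ ∫ U, plaquetteCost r.ρ U (Literature.Probability.LatticeModels.Torus.proj (2 * L + 1) x, q) ^ 2
            ∂(wilsonMeasure (d := 4) (L := 2 * L + 1) r.ρ β) -
          (∫ U, plaquetteCost r.ρ U (Literature.Probability.LatticeModels.Torus.proj (2 * L + 1) x, q)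
            ∂(wilsonMeasure (d := 4) (L := 2 * L + 1) r.ρ β)) ^ 2 ∧
      ∫ U, plaquetteCost r.ρ U (Literature.Probability.LatticeModels.Torus.proj (2 * L + 1) x, q) ^ 2
            ∂(wilsonMeasure (d := 4) (L := 2 * L + 1) r.ρ β) -
          (∫ U, plaquetteCost r.ρ U (Literature.Probability.LatticeModels.Torus.proj (2 * L + 1) x, q)
            ∂(wilsonMeasure (d := 4) (L := 2 * L + 1) r.ρ β)) ^ 2 ≤ C / β ^ 2 := by
  haveI := r.secondCountableTopology
  obtain ⟨c, β₀, hc, hβ₀, hfloor⟩ := exists_torusVar_plaquetteCost_ge G r hD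
  obtain ⟨K, hK0, hK⟩ := Summit.QuantumFields.YangMills.Cruxes.NT.SharpCeilings.exists_plaquetteCost_moments_le_sharp G r
  refine ⟨c, max c K, max β₀ 4, hc, le_max_left _ _, lt_of_lt_of_le hβ₀ (le_max_left _ _), fun β hβ L hL x q => ?_⟩
  have hββ₀ : β₀ ≤ β := (le_max_left _ _).trans hβ
  have hβ4 : 4 ≤ β := (le_max_right _ _).trans hβ
  haveI : NeZero (2 * L + 1) := ⟨by omega⟩
  set μT := wilsonMeasure (d := 4) (L := 2 * L + 1) (G := G) r.ρ β with hμT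
  haveI : IsProbabilityMeasure μT := isProbabilityMeasure_wilsonMeasure (d := 4) (L := 2 * L + 1) r.ρ r.continuous β
  set qT : Plaquette 4 (2 * L + 1) := (Literature.Probability.LatticeModels.Torus.proj (2 * L + 1) x, q) with hqT
  have hmeas : Measurable fun U : GaugeConfig 4 (2 * L + 1) G => plaquetteCost r.ρ U qT :=
    measurable_const.sub (measurable_plaqRe r.ρ r.continuous qT)
  have hbd : ∀ U : GaugeConfig 4 (2 * L + 1) G, |plaquetteCost r.ρ U qT| ≤ 2 * r.N := by
    intro U
    have h := abs_le.1 (abs_plaqRe_le r.ρ r.continuous U qT)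
    change |(r.N : ℝ) - plaqRe r.ρ U qT| ≤ 2 * r.N
    rw [abs_le]; constructor <;> linarith [h.1, h.2]
  have hvar := integral_sq_sub_integral_eq μT hmeas hbd
  constructor
  · have h := hfloor β hββ₀ L hL x q
    rw [hvar] at h
    exact h
  · have h2 := (hK L (le_trans one_le_two hL) β hβ4 qT).2
    have hm2 : 0 ≤ (∫ U, plaquetteCost r.ρ U qT ∂μT) ^ 2 := sq_nonneg _
    have hβ0 : 0 < β := by linarith
    calc ∫ U, plaquetteCost r.ρ U qT ^ 2 ∂μT - (∫ U, plaquetteCost r.ρ U qT ∂μT) ^ 2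
        ≤ ∫ U, plaquetteCost r.ρ U qT ^ 2 ∂μT := by linarith
      _ ≤ K / β ^ 2 := h2
      _ ≤ max c K / β ^ 2 := div_le_div_of_nonneg_right (le_max_right _ _) (by positivity)

/-- **The two-sided variance pin for compact SIMPLE gauge groups** (no dimension hypothesis). [folklore] -/
theorem torusVar_plaquetteCost_pin_of_simple (hG : IsCompactSimpleLieGroup G) :
    ∃ c C β₀ : ℝ, 0 < c ∧ c ≤ C ∧ 0 < β₀ ∧ ∀ β : ℝ, β₀ ≤ β → ∀ (L : ℕ), 2 ≤ L →
      ∀ (x : Fin 4 → ℤ) (q : {q : Fin 4 × Fin 4 // q.1 < q.2}),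
      c / β ^ 2 ≤ ∫ U, plaquetteCost r.ρ U (Literature.Probability.LatticeModels.Torus.proj (2 * L + 1) x, q) ^ 2
            ∂(wilsonMeasure (d := 4) (L := 2 * L + 1) r.ρ β) -
          (∫ U, plaquetteCost r.ρ U (Literature.Probability.LatticeModels.Torus.proj (2 * L + 1) x, q)
            ∂(wilsonMeasure (d := 4) (L := 2 * L + 1) r.ρ β)) ^ 2 ∧
      ∫ U, plaquetteCost r.ρ U (Literature.Probability.LatticeModels.Torus.proj (2 * L + 1) x, q) ^ 2
            ∂(wilsonMeasure (d := 4) (L := 2 * L + 1) r.ρ β) -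
          (∫ U, plaquetteCost r.ρ U (Literature.Probability.LatticeModels.Torus.proj (2 * L + 1) x, q)
            ∂(wilsonMeasure (d := 4) (L := 2 * L + 1) r.ρ β)) ^ 2 ≤ C / β ^ 2 :=
  torusVar_plaquetteCost_pin G r (dimE_pos_of_isCompactSimpleLieGroup G r hG)

end Torus

end Summit.QuantumFields.YangMills.Cruxes.NT.LinkEquipartition

end
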